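import Mathlib
import Summits.ValiantsHypothesis.ValiantsHypothesis.Theorems.RigidityForcesSymmetryRankRigidMinimalReprLaplaceFiveSectorSplitDefs
import Summits.ValiantsHypothesis.ValiantsHypothesis.Theorems.RigidityForcesSymmetryRankRigidMinimalReprLaplaceFiveTriangleNoSideSym
import Summits.ValiantsHypothesis.ValiantsHypothesis.Theorems.RigidityForcesSymmetryRankRigidMinimalReprLaplaceFiveSlackCoherence

/-!
# ValiantsHypothesis / RigidityForcesSymmetry — crux `LaplaceOptimalFive` (stmt-ValiantsHypothesis-24813), crux idea
`young-shadow` (K1) ON THE STAR: **THE EXCHANGE IDENTITY OF A STAR SHADOW IN LETTER CURRENCY** (blueprint step F0b / memo §9)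

For a side-symmetric pair decomposition of `P₅` supported on the star `{pa, pb, pc, pd}`, ✓ `star_coherence` (conjunct 4) says that the
shadow `Z` of `{p,a}` symmetrised over the star is fully slot-symmetric.  Read at the word placing letters `A,B,C,D,E` on the slots
`p,a,b,c,d`, invariance under the slot transposition `(p a)` is the LETTER identity

  `Z(ABCDE) + Z(ACBDE) + Z(ADCBE) + Z(AECDB) = Z(BACDE) + Z(BCADE) + Z(BDCAE) + Z(BECDA)`

(«closedness», `𝒦 = FSym ⊕ S₍₃,₂₎` of the memo `NOTE-p4g15-24813-K1-star.md` §2; for a single product term it is the hypothesis `(C)` of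
✓ `LaplaceFiveStar.rankOne_closed`, cf. ✓ `lone_term_crossSwap`).  This file proves it for an ARBITRARY shadow (any number of terms), as
the entry point of the star assembly (memo §9: the remaining input is the one geometric stub LEMMA 2′); `star_shadows_congruent` is
the companion congruence of two star shadows (exchange lemma), and `closed_vertex_sum` the pure-linear-algebra consequence of
closedness for a letter tensor `H`: all vertex sums `s(x) = Σ_{y} h_{xy}` agree, `s(a) = (2/5)Σ_{pairs} h` — i.e. `E := H − F`,
`F = (1/10)Σ_{pairs} h` the fully symmetric part, has `E·y = 0` (the decomposition `H = Hess f + E` of `𝒦 = FSym ⊕ S₍₃,₂₎`).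
Appended (r4): `square_of_symmetric_tensor`, `columns_in_span_of_symmetric_tensor` — the two pencil identities closing the
elementary proof of LEMMA 2′ (referee's LEMMA K, case (c2)): square member resp. binary pencil.

Honest framing.  Bookkeeping; K1 on the star in general, S2′, `LaplaceOptimalFive` (OPEN · CONTESTED 72/120), `RankRigidMinimalRepr`,
`VP ≠ VNP` are NOT proved.  No definitions, no `sorry`; Mathlib + tree only.
-/

set_option linter.dupNamespace false
set_option linter.unusedSimpArgs false

namespace Summit.ValiantsHypothesis.ValiantsHypothesis.Theorems.RigidityForcesSymmetryRankRigidMinimalRepr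

namespace LaplaceFiveStar

open Finset LaplaceFiveSectorSplit

variable {N : ℕ}

/-- **Exchange identity of a star shadow (letter currency).**  Star `{pa,pb,pc,pd}` with the four splits labelled; `Z` the shadow of
`{p,a}`; at the word with letters `A,B,C,D,E` on the slots `p,a,b,c,d` (any filler elsewhere — there is no elsewhere) the
star-symmetrisation of `Z` is invariant under `(p a)`. [folklore] -/
theorem star_shadow_exchange (p a b c d : Fin 5) (hpa : p ≠ a) (hpb : p ≠ b) (hpc : p ≠ c) (hpd : p ≠ d) (hab : a ≠ b)
    (hac : a ≠ c) (had : a ≠ d) (hbc : b ≠ c) (hbd : b ≠ d) (hcd : c ≠ d)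
    (T : Finset (Fin N)) (S : Fin N → Finset (Fin 5)) (u w : Fin N → (Fin 5 → Fin 5) → ℂ)
    (hdec : IsSplitDecomposition T S u w) (hsym : SideSymmetric T S u w)
    (hI : T.image S = {({p, a} : Finset (Fin 5)), {p, b}, {p, c}, {p, d}}) :
    ∀ A B C D E : Fin 5,
      (∑ t ∈ T.filter (fun t => S t = {p, a}),
          u t (fun i => if i = p then A else if i = a then B else if i = b then C else if i = c then D else E)
          * w t (fun i => if i = p then A else if i = a then B else if i = b then C else if i = c then D else E))
      + (∑ t ∈ T.filter (fun t => S t = {p, a}),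
          u t (fun i => if i = p then A else if i = a then C else if i = b then B else if i = c then D else E)
          * w t (fun i => if i = p then A else if i = a then C else if i = b then B else if i = c then D else E))
      + (∑ t ∈ T.filter (fun t => S t = {p, a}),
          u t (fun i => if i = p then A else if i = a then D else if i = b then C else if i = c then B else E)
          * w t (fun i => if i = p then A else if i = a then D else if i = b then C else if i = c then B else E))
      + (∑ t ∈ T.filter (fun t => S t = {p, a}),
          u t (fun i => if i = p then A else if i = a then E else if i = b then C else if i = c then D else B)
          * w t (fun i => if i = p then A else if i = a then E else if i = b then C else if i = c then D else B))
      = (∑ t ∈ T.filter (fun t => S t = {p, a}),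
          u t (fun i => if i = p then B else if i = a then A else if i = b then C else if i = c then D else E)
          * w t (fun i => if i = p then B else if i = a then A else if i = b then C else if i = c then D else E))
      + (∑ t ∈ T.filter (fun t => S t = {p, a}),
          u t (fun i => if i = p then B else if i = a then C else if i = b then A else if i = c then D else E)
          * w t (fun i => if i = p then B else if i = a then C else if i = b then A else if i = c then D else E))
      + (∑ t ∈ T.filter (fun t => S t = {p, a}),
          u t (fun i => if i = p then B else if i = a then D else if i = b then C else if i = c then A else E)
          * w t (fun i => if i = p then B else if i = a then D else if i = b then C else if i = c then A else E))
      + (∑ t ∈ T.filter (fun t => S t = {p, a}),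
          u t (fun i => if i = p then B else if i = a then E else if i = b then C else if i = c then D else A)
          * w t (fun i => if i = p then B else if i = a then E else if i = b then C else if i = c then D else A)) := by
  classical
  intro A B C D E
  obtain ⟨hu, hw, hid⟩ := hdec
  -- the five slots exhaust `Fin 5`
  have hcover : ∀ i : Fin 5, i = p ∨ i = a ∨ i = b ∨ i = c ∨ i = d := by
    have hc5 : ({p, a, b, c, d} : Finset (Fin 5)).card = 5 := by
      rw [Finset.card_insert_of_notMem, Finset.card_insert_of_notMem, Finset.card_insert_of_notMem,
        Finset.card_pair hcd]
      · simp [hbc, hbd]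
      · simp [hab, hac, had]
      · simp [hpa, hpb, hpc, hpd]
    have huniv := Finset.eq_univ_of_card _ (by rw [hc5]; simp)
    intro i
    have hi : i ∈ ({p, a, b, c, d} : Finset (Fin 5)) := by rw [huniv]; exact Finset.mem_univ i
    simpa using hi
  -- shadows and their side symmetry
  set Z : Finset (Fin 5) → (Fin 5 → Fin 5) → ℂ := fun X v => ∑ t ∈ T.filter (fun t => S t = X), u t v * w t v with hZ
  have hside : ∀ X : Finset (Fin 5), SlotInvariantOn X (Z X) ∧ SlotInvariantOn Xᶜ (Z X) := fun X =>
    ⟨fun τ hτ v => LaplaceFiveTriangleSeparation.shadow_inv_left T S u w hw hsym X τ hτ v,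
      fun τ hτ v => LaplaceFiveTriangleSeparation.shadow_inv_right T S u w hu hsym X τ hτ v⟩
  have hfib : ∀ v : Fin 5 → Fin 5, ∑ X ∈ T.image S, Z X v = if Function.Injective v then 1 else 0 := by
    intro v
    simp only [hZ]
    rw [Finset.sum_fiberwise_of_maps_to (g := S) (fun t (ht : t ∈ T) => Finset.mem_image_of_mem S ht)]
    exact hid v
  -- distinctness of the four splits
  have ne : ∀ x y : Fin 5, x ≠ y → p ≠ y → ({p, x} : Finset (Fin 5)) ≠ {p, y} := by
    intro x y hxy hpy h
    have hy : y ∈ ({p, x} : Finset (Fin 5)) := by rw [h]; simp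
    simp only [Finset.mem_insert, Finset.mem_singleton] at hy
    rcases hy with hy | hy
    · exact hpy hy.symm
    · exact hxy hy.symm
  have hsum4 : SlotInvariantOn Finset.univ (Z {p, a} + Z {p, b} + Z {p, c} + Z {p, d}) := by
    have e : Z {p, a} + Z {p, b} + Z {p, c} + Z {p, d} = fun v => ∑ X ∈ T.image S, Z X v := by
      funext v
      rw [hI, Finset.sum_insert, Finset.sum_insert, Finset.sum_insert, Finset.sum_singleton]
      · simp only [Pi.add_apply]; ring
      · simp only [Finset.mem_singleton]; exact ne c d hcd hpd
      · simp only [Finset.mem_insert, Finset.mem_singleton, not_or]; exact ⟨ne b c hbc hpc, ne b d hbd hpd⟩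
      · simp only [Finset.mem_insert, Finset.mem_singleton, not_or]
        exact ⟨ne a b hab hpb, ne a c hac hpc, ne a d had hpd⟩
    rw [e]
    intro τ _ v
    show (∑ X ∈ T.image S, Z X (v ∘ ⇑τ)) = ∑ X ∈ T.image S, Z X v
    rw [hfib, hfib, if_congr (Equiv.injective_comp τ v) rfl rfl]
  have coh := star_coherence p a b c d hpa hpb hpc hpd hab hac had hbc hbd hcd (Z {p, a}) (Z {p, b}) (Z {p, c}) (Z {p, d})
    (hside _) (hside _) (hside _) (hside _) hsum4
  have hsymm4 := coh.2.2.2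
  -- the word and its transforms
  set ω : Fin 5 → Fin 5 := fun i => if i = p then A else if i = a then B else if i = b then C else if i = c then D else E with hω
  have hq := hsymm4 (Equiv.swap p a) (fun i hi => absurd (Finset.mem_univ i) hi) ω
  simp only [Pi.add_apply] at hq
  -- rewrite the eight composed words
  have w1 : ω ∘ ⇑(Equiv.swap a b)
      = (fun i => if i = p then A else if i = a then C else if i = b then B else if i = c then D else E) := by
    funext i
    rcases hcover i with rfl | rfl | rfl | rfl | rfl <;>
      simp [Function.comp_apply, Equiv.swap_apply_def, hω, hpa, hpb, hpc, hpd, hab, hac, had, hbc, hbd, hcd, hpa.symm, hpb.symm, hpc.symm, hpd.symm, hab.symm, hac.symm, had.symm, hbc.symm, hbd.symm, hcd.symm]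
  have w2 : ω ∘ ⇑(Equiv.swap a c)
      = (fun i => if i = p then A else if i = a then D else if i = b then C else if i = c then B else E) := by
    funext i
    rcases hcover i with rfl | rfl | rfl | rfl | rfl <;>
      simp [Function.comp_apply, Equiv.swap_apply_def, hω, hpa, hpb, hpc, hpd, hab, hac, had, hbc, hbd, hcd, hpa.symm, hpb.symm, hpc.symm, hpd.symm, hab.symm, hac.symm, had.symm, hbc.symm, hbd.symm, hcd.symm]
  have w3 : ω ∘ ⇑(Equiv.swap a d)
      = (fun i => if i = p then A else if i = a then E else if i = b then C else if i = c then D else B) := by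
    funext i
    rcases hcover i with rfl | rfl | rfl | rfl | rfl <;>
      simp [Function.comp_apply, Equiv.swap_apply_def, hω, hpa, hpb, hpc, hpd, hab, hac, had, hbc, hbd, hcd, hpa.symm, hpb.symm, hpc.symm, hpd.symm, hab.symm, hac.symm, had.symm, hbc.symm, hbd.symm, hcd.symm]
  have w0' : ω ∘ ⇑(Equiv.swap p a)
      = (fun i => if i = p then B else if i = a then A else if i = b then C else if i = c then D else E) := by
    funext i
    rcases hcover i with rfl | rfl | rfl | rfl | rfl <;>
      simp [Function.comp_apply, Equiv.swap_apply_def, hω, hpa, hpb, hpc, hpd, hab, hac, had, hbc, hbd, hcd, hpa.symm, hpb.symm, hpc.symm, hpd.symm, hab.symm, hac.symm, had.symm, hbc.symm, hbd.symm, hcd.symm]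
  have w1' : (fun i => if i = p then B else if i = a then A else if i = b then C else if i = c then D else E) ∘ ⇑(Equiv.swap a b)
      = (fun i => if i = p then B else if i = a then C else if i = b then A else if i = c then D else E) := by
    funext i
    rcases hcover i with rfl | rfl | rfl | rfl | rfl <;>
      simp [Function.comp_apply, Equiv.swap_apply_def, hω, hpa, hpb, hpc, hpd, hab, hac, had, hbc, hbd, hcd, hpa.symm, hpb.symm, hpc.symm, hpd.symm, hab.symm, hac.symm, had.symm, hbc.symm, hbd.symm, hcd.symm]
  have w2' : (fun i => if i = p then B else if i = a then A else if i = b then C else if i = c then D else E) ∘ ⇑(Equiv.swap a c)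
      = (fun i => if i = p then B else if i = a then D else if i = b then C else if i = c then A else E) := by
    funext i
    rcases hcover i with rfl | rfl | rfl | rfl | rfl <;>
      simp [Function.comp_apply, Equiv.swap_apply_def, hω, hpa, hpb, hpc, hpd, hab, hac, had, hbc, hbd, hcd, hpa.symm, hpb.symm, hpc.symm, hpd.symm, hab.symm, hac.symm, had.symm, hbc.symm, hbd.symm, hcd.symm]
  have w3' : (fun i => if i = p then B else if i = a then A else if i = b then C else if i = c then D else E) ∘ ⇑(Equiv.swap a d)
      = (fun i => if i = p then B else if i = a then E else if i = b then C else if i = c then D else A) := by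
    funext i
    rcases hcover i with rfl | rfl | rfl | rfl | rfl <;>
      simp [Function.comp_apply, Equiv.swap_apply_def, hω, hpa, hpb, hpc, hpd, hab, hac, had, hbc, hbd, hcd, hpa.symm, hpb.symm, hpc.symm, hpd.symm, hab.symm, hac.symm, had.symm, hbc.symm, hbd.symm, hcd.symm]
  rw [w1, w2, w3, w0', w1', w2', w3'] at hq
  simp only [hZ, hω] at hq
  exact hq.symm

/-- **Congruence of two star shadows (letter currency).**  With `ω` placing `A,B,C,D,E` on `p,a,b,c,d` and `ω'` the same word with the
letters on the slots `a,b` exchanged: `Z_{pb}(ω') − Z_{pa}(ω) = Z_{pb}(ω) − Z_{pa}(ω')` — read at their own splits, the letter tensors of the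
shadows of `{p,b}` and `{p,a}` differ by a FULLY symmetric tensor (✓ `star_coherence` conj. 1 / the exchange lemma; the other leaves by
relabelling). [folklore] -/
theorem star_shadows_congruent (p a b c d : Fin 5) (hpa : p ≠ a) (hpb : p ≠ b) (hpc : p ≠ c) (hpd : p ≠ d) (hab : a ≠ b)
    (hac : a ≠ c) (had : a ≠ d) (hbc : b ≠ c) (hbd : b ≠ d) (hcd : c ≠ d)
    (T : Finset (Fin N)) (S : Fin N → Finset (Fin 5)) (u w : Fin N → (Fin 5 → Fin 5) → ℂ)
    (hdec : IsSplitDecomposition T S u w) (hsym : SideSymmetric T S u w)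
    (hI : T.image S = {({p, a} : Finset (Fin 5)), {p, b}, {p, c}, {p, d}}) :
    ∀ A B C D E : Fin 5,
      (∑ t ∈ T.filter (fun t => S t = {p, b}),
          u t (fun i => if i = p then A else if i = a then C else if i = b then B else if i = c then D else E)
          * w t (fun i => if i = p then A else if i = a then C else if i = b then B else if i = c then D else E))
      - (∑ t ∈ T.filter (fun t => S t = {p, a}),
          u t (fun i => if i = p then A else if i = a then B else if i = b then C else if i = c then D else E)
          * w t (fun i => if i = p then A else if i = a then B else if i = b then C else if i = c then D else E))
      = (∑ t ∈ T.filter (fun t => S t = {p, b}),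
          u t (fun i => if i = p then A else if i = a then B else if i = b then C else if i = c then D else E)
          * w t (fun i => if i = p then A else if i = a then B else if i = b then C else if i = c then D else E))
      - (∑ t ∈ T.filter (fun t => S t = {p, a}),
          u t (fun i => if i = p then A else if i = a then C else if i = b then B else if i = c then D else E)
          * w t (fun i => if i = p then A else if i = a then C else if i = b then B else if i = c then D else E)) := by
  classical
  intro A B C D E
  obtain ⟨hu, hw, hid⟩ := hdec
  have hcover : ∀ i : Fin 5, i = p ∨ i = a ∨ i = b ∨ i = c ∨ i = d := by
    have hc5 : ({p, a, b, c, d} : Finset (Fin 5)).card = 5 := by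
      rw [Finset.card_insert_of_notMem, Finset.card_insert_of_notMem, Finset.card_insert_of_notMem,
        Finset.card_pair hcd]
      · simp [hbc, hbd]
      · simp [hab, hac, had]
      · simp [hpa, hpb, hpc, hpd]
    have huniv := Finset.eq_univ_of_card _ (by rw [hc5]; simp)
    intro i
    have hi : i ∈ ({p, a, b, c, d} : Finset (Fin 5)) := by rw [huniv]; exact Finset.mem_univ i
    simpa using hi
  set Z : Finset (Fin 5) → (Fin 5 → Fin 5) → ℂ := fun X v => ∑ t ∈ T.filter (fun t => S t = X), u t v * w t v with hZ
  have hside : ∀ X : Finset (Fin 5), SlotInvariantOn X (Z X) ∧ SlotInvariantOn Xᶜ (Z X) := fun X =>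
    ⟨fun τ hτ v => LaplaceFiveTriangleSeparation.shadow_inv_left T S u w hw hsym X τ hτ v,
      fun τ hτ v => LaplaceFiveTriangleSeparation.shadow_inv_right T S u w hu hsym X τ hτ v⟩
  have hfib : ∀ v : Fin 5 → Fin 5, ∑ X ∈ T.image S, Z X v = if Function.Injective v then 1 else 0 := by
    intro v
    simp only [hZ]
    rw [Finset.sum_fiberwise_of_maps_to (g := S) (fun t (ht : t ∈ T) => Finset.mem_image_of_mem S ht)]
    exact hid v
  have ne : ∀ x y : Fin 5, x ≠ y → p ≠ y → ({p, x} : Finset (Fin 5)) ≠ {p, y} := by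
    intro x y hxy hpy h
    have hy : y ∈ ({p, x} : Finset (Fin 5)) := by rw [h]; simp
    simp only [Finset.mem_insert, Finset.mem_singleton] at hy
    rcases hy with hy | hy
    · exact hpy hy.symm
    · exact hxy hy.symm
  have hsum : ∀ v : Fin 5 → Fin 5, Z {p, a} v + Z {p, b} v + Z {p, c} v + Z {p, d} v = if Function.Injective v then 1 else 0 := by
    intro v
    rw [← hfib v, hI, Finset.sum_insert, Finset.sum_insert, Finset.sum_insert, Finset.sum_singleton]
    · ring
    · simp only [Finset.mem_singleton]; exact ne c d hcd hpd
    · simp only [Finset.mem_insert, Finset.mem_singleton, not_or]; exact ⟨ne b c hbc hpc, ne b d hbd hpd⟩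
    · simp only [Finset.mem_insert, Finset.mem_singleton, not_or]
      exact ⟨ne a b hab hpb, ne a c hac hpc, ne a d had hpd⟩
  -- the word and its (a b)-swap
  set ω : Fin 5 → Fin 5 := fun i => if i = p then A else if i = a then B else if i = b then C else if i = c then D else E with hω
  have w1 : ω ∘ ⇑(Equiv.swap a b)
      = (fun i => if i = p then A else if i = a then C else if i = b then B else if i = c then D else E) := by
    funext i
    rcases hcover i with rfl | rfl | rfl | rfl | rfl <;>
      simp [Function.comp_apply, Equiv.swap_apply_def, hω, hpa, hpb, hpc, hpd, hab, hac, had, hbc, hbd, hcd, hpa.symm, hpb.symm, hpc.symm, hpd.symm, hab.symm, hac.symm, had.symm, hbc.symm, hbd.symm, hcd.symm]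
  -- Z_c, Z_d and the indicator are invariant under the slot swap (a b)
  have hc' : Z {p, c} (ω ∘ ⇑(Equiv.swap a b)) = Z {p, c} ω :=
    invUnder_swap_of_not_mem (A := ({p, c} : Finset (Fin 5))) (hside _).2 (by simp [hpa, hpb, hpc, hpd, hab, hac, had, hbc, hbd, hcd, hpa.symm, hpb.symm, hpc.symm, hpd.symm, hab.symm, hac.symm, had.symm, hbc.symm, hbd.symm, hcd.symm]) (by simp [hpa, hpb, hpc, hpd, hab, hac, had, hbc, hbd, hcd, hpa.symm, hpb.symm, hpc.symm, hpd.symm, hab.symm, hac.symm, had.symm, hbc.symm, hbd.symm, hcd.symm]) ω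
  have hd' : Z {p, d} (ω ∘ ⇑(Equiv.swap a b)) = Z {p, d} ω :=
    invUnder_swap_of_not_mem (A := ({p, d} : Finset (Fin 5))) (hside _).2 (by simp [hpa, hpb, hpc, hpd, hab, hac, had, hbc, hbd, hcd, hpa.symm, hpb.symm, hpc.symm, hpd.symm, hab.symm, hac.symm, had.symm, hbc.symm, hbd.symm, hcd.symm]) (by simp [hpa, hpb, hpc, hpd, hab, hac, had, hbc, hbd, hcd, hpa.symm, hpb.symm, hpc.symm, hpd.symm, hab.symm, hac.symm, had.symm, hbc.symm, hbd.symm, hcd.symm]) ω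
  have h1 := hsum ω
  have h2 := hsum (ω ∘ ⇑(Equiv.swap a b))
  rw [if_congr (Equiv.injective_comp (Equiv.swap a b) ω) rfl rfl, hc', hd', w1] at h2
  simp only [hZ, hω] at h1 h2
  linear_combination h2 - h1

/-- **Vertex-sum identity of a closed letter tensor**: under `(C_H)`, `h_{ab}+h_{ac}+h_{ad}+h_{ae} = (2/5)·Σ_{pairs} h_{xy}`
(equivalently `E := H − (1/10)Σ h` has `Σ_{x∈{b,c,d,e}} E(a,x,rest) = 0`, i.e. `E·y = 0`). [folklore] -/
theorem closed_vertex_sum (H : Fin 5 → Fin 5 → Fin 5 → Fin 5 → Fin 5 → ℂ)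
    (h12 : ∀ a b c d e : Fin 5, H a b c d e = H b a c d e) (h34 : ∀ a b c d e : Fin 5, H a b c d e = H a b d c e)
    (h45 : ∀ a b c d e : Fin 5, H a b c d e = H a b c e d)
    (hC : ∀ A B C D E : Fin 5, H A B C D E + H A C B D E + H A D C B E + H A E C D B
      = H B A C D E + H B C A D E + H B D C A E + H B E C D A) (a b c d e : Fin 5) :
    H a b c d e + H a c b d e + H a d b c e + H a e b c d
      = (2 / 5 : ℂ) * (H a b c d e + H a c b d e + H a d b c e + H a e b c d + H b c a d e + H b d a c e + H b e a c d + H c d a b e + H c e a b d + H d e a b c) := by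
  have i1 : H a b c d e + H a c b d e + H a d b c e + H a e b c d = H a b c d e + H b c a d e + H b d a c e + H b e a c d := by
    have t := hC a b c d e
    rw [h34 a d c b e, h45 a e c d b, h34 a e c b d, h12 b a c d e, h34 b d c a e, h45 b e c d a, h34 b e c a d] at t
    exact t
  have i2 : H a c b d e + H a b c d e + H a d b c e + H a e b c d = H a c b d e + H b c a d e + H c d a b e + H c e a b d := by
    have t := hC a c b d e
    rw [h45 a e b d c, h12 c a b d e, h12 c b a d e, h34 c d b a e, h45 c e b d a, h34 c e b a d] at t
    exact t
  have i3 : H a d b c e + H a b c d e + H a c b d e + H a e b c d = H a d b c e + H b d a c e + H c d a b e + H d e a b c := by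
    have t := hC a d b c e
    rw [h34 a b d c e, h12 d a b c e, h12 d b a c e, h12 d c b a e, h34 c d b a e, h45 d e b c a, h34 d e b a c] at t
    exact t
  have i4 : H a e b c d + H a b c d e + H a c b d e + H a d b c e = H a e b c d + H b e a c d + H c e a b d + H d e a b c := by
    have t := hC a e b c d
    rw [h34 a b e c d, h45 a b c e d, h45 a c b e d, h12 e a b c d, h12 e b a c d, h12 e c b a d, h34 c e b a d, h12 e d b c a, h45 d e b c a, h34 d e b a c] at t
    exact t
  linear_combination (1 / 5 : ℂ) * (i1 + i2 + i3 + i4)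

/-! ### Pencil linear algebra for LEMMA K / LEMMA 2′ (memo §12; referee note `NOTE-crit3g5-24813-Lemma2prime-elementary.md` §B (c2))
Two letter-currency identities used at the end of the elementary proof of LEMMA 2′: a fully symmetric tensor of the shape `λ ⊗ M` is a
multiple of `λ ⊗ λ ⊗ λ` (so a pencil member `M` with `λ ⊗ M` fully symmetric is the SQUARE `c·λλᵀ`), and a fully symmetric tensor of the
shape `a ⊗ U₁ + b ⊗ U₂` with `a ∦ b` has all columns of `U₁, U₂` inside `span{a, b}` (so the pencil is BINARY).  Pure algebra over `ℂ`. -/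

/-- **Square member.**  If `λ z · M x w` is symmetric in `(z, x)` and `M` is symmetric, then at any `z₀` with `λ z₀ ≠ 0`:
`λ z₀² · M x w = M z₀ z₀ · λ x · λ w`, i.e. `M = c·λλᵀ`. [folklore] -/
theorem square_of_symmetric_tensor (lam : Fin 5 → ℂ) (M : Fin 5 → Fin 5 → ℂ) (hM : ∀ x w : Fin 5, M x w = M w x)
    (h : ∀ z x w : Fin 5, lam z * M x w = lam x * M z w) (z₀ x w : Fin 5) :
    lam z₀ * lam z₀ * M x w = M z₀ z₀ * (lam x * lam w) := by
  have h1 := h z₀ x w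
  have h2 := h z₀ w z₀
  have h3 := hM z₀ w
  linear_combination lam z₀ * h1 + lam x * h2 + lam x * lam z₀ * h3

/-- **Binary pencil (Cramer step).**  If `a z · U₁ x w + b z · U₂ x w` is symmetric in `(z, x)`, then for all `i j x w`, with
`D := a i · b j − a j · b i`: `D · U₁ x w` and `D · U₂ x w` are explicit combinations of `a x` and `b x` — every column of `U₁` and of
`U₂` lies in `span{a, b}` as soon as `D ≠ 0`. [folklore] -/
theorem columns_in_span_of_symmetric_tensor (a b : Fin 5 → ℂ) (U₁ U₂ : Fin 5 → Fin 5 → ℂ)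
    (h : ∀ z x w : Fin 5, a z * U₁ x w + b z * U₂ x w = a x * U₁ z w + b x * U₂ z w) (i j x w : Fin 5) :
    (a i * b j - a j * b i) * U₁ x w = a x * (b j * U₁ i w - b i * U₁ j w) + b x * (b j * U₂ i w - b i * U₂ j w) ∧
    (a i * b j - a j * b i) * U₂ x w = a x * (a i * U₁ j w - a j * U₁ i w) + b x * (a i * U₂ j w - a j * U₂ i w) := by
  have h1 := h i x w
  have h2 := h j x w
  constructor
  · linear_combination b j * h1 - b i * h2
  · linear_combination a i * h2 - a j * h1

end LaplaceFiveStar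

end Summit.ValiantsHypothesis.ValiantsHypothesis.Theorems.RigidityForcesSymmetryRankRigidMinimalRepr
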